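import Mathlib
import Summits.Ventures.PercRepro2.Defs
import Summits.Ventures.PercRepro2.Independence
import Summits.Ventures.PercRepro2.Harris
import Summits.Ventures.PercRepro2.CoinDefs
import Summits.Ventures.PercRepro2.CoinArcsOff
import Summits.Ventures.PercRepro2.CoinPendantDefs
import Summits.Ventures.PercRepro2.CoinPendant
import Summits.Ventures.PercRepro2.CoinInduced
import Summits.Ventures.PercRepro2.CoinVdBK
import Summits.Ventures.PercRepro2.CoinBHK
import Summits.Ventures.PercRepro2.CoinReverse
import Summits.Ventures.PercRepro2.CoinLemmaA
import Summits.Ventures.PercRepro2.CoinDarcMixed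
import Summits.Ventures.PercRepro2.CoinTwoPendantDefs
import Summits.Ventures.PercRepro2.CoinTwoPendantMass
import Summits.Ventures.PercRepro2.CoinTraceLevels
import Summits.Ventures.PercRepro2.CoinTraceTower
import Summits.Ventures.PercRepro2.CoinTracePin
import Summits.Ventures.PercRepro2.CoinTracePin2
import Summits.Ventures.PercRepro2.CoinTracePinTransfer
import Summits.Ventures.PercRepro2.CoinTraceReduce
import Summits.Ventures.PercRepro2.CoinTraceFn
import Summits.Ventures.PercRepro2.CoinTraceBlock
import Summits.Ventures.PercRepro2.CoinTraceShift
import Summits.Ventures.PercRepro2.CoinTwoStarAbstract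
import Summits.Ventures.PercRepro2.CoinTwoStar
import Summits.Ventures.PercRepro2.CoinTraceBlocks
import Summits.Ventures.PercRepro2.CoinTraceBlocks2
import Summits.Ventures.PercRepro2.CoinPathStarAbstract
import Summits.Ventures.PercRepro2.CoinPathStar
import Summits.Ventures.PercRepro2.CoinPathStarHard
import Summits.Ventures.PercRepro2.CoinPathStarAbstract2
import Summits.Ventures.PercRepro2.CoinPathStarAll

/-!
# The literal PATHSTAR: five single-arc coins `w → v₁, v₁ → v₂, v₂ → t, w → v₃, v₃ → t` (blind
cell PercRepro2, night-2 g4; proofs/NIGHT2-DARC.md §23)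

`darc_of_pathStar_coins`: if the five pathstar coins are the ONLY coins with tails in
`{w, v₁, v₂, v₃}` (`OnlyPathStarCoins`; entries into the pendant set from outside are arbitrary
single arcs, the rest of the system is any `SameEnds` coin system), then the structural
hypotheses of `darc_of_pathStar_mixed` hold and row 2′DARC holds at the head `w` on ALL regimes
(no subadditivity hypothesis).
-/

namespace Summit.Ventures.PercRepro2.Coin

section PathStarCoins

variable {V : Type*} {E : Type*} [DecidableEq V]

/-- The five pathstar coins are the only coins carrying an arc with tail in `{w, v₁, v₂, v₃}`. -/
def OnlyPathStarCoins (arcs : E → Finset (V × V)) (w v₁ v₂ v₃ : V) (e₁ e₂ e₃ e₄ e₅ : E) : Prop :=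
  ∀ e, (∃ xy ∈ arcs e, xy.1 = w ∨ xy.1 = v₁ ∨ xy.1 = v₂ ∨ xy.1 = v₃) →
    e = e₁ ∨ e = e₂ ∨ e = e₃ ∨ e = e₄ ∨ e = e₅

variable {arcs : E → Finset (V × V)} {w v₁ v₂ v₃ t : V} {e₁ e₂ e₃ e₄ e₅ : E}
  (h₁ : arcs e₁ = {(w, v₁)}) (h₂ : arcs e₂ = {(v₁, v₂)}) (h₃ : arcs e₃ = {(v₂, t)})
  (h₄ : arcs e₄ = {(w, v₃)}) (h₅ : arcs e₅ = {(v₃, t)})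
  (honly : OnlyPathStarCoins arcs w v₁ v₂ v₃ e₁ e₂ e₃ e₄ e₅)

include h₁ h₂ h₃ h₄ h₅ honly

omit [DecidableEq V] in
/-- An arc with tail in the pendant set is one of the five pathstar arcs. -/
lemma pathStar_arc {e : E} {x y : V} (hxy : (x, y) ∈ arcs e)
    (hx : x = w ∨ x = v₁ ∨ x = v₂ ∨ x = v₃) :
    (e = e₁ ∧ x = w ∧ y = v₁) ∨ (e = e₂ ∧ x = v₁ ∧ y = v₂) ∨ (e = e₃ ∧ x = v₂ ∧ y = t) ∨
      (e = e₄ ∧ x = w ∧ y = v₃) ∨ (e = e₅ ∧ x = v₃ ∧ y = t) := by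
  rcases honly e ⟨(x, y), hxy, hx⟩ with rfl | rfl | rfl | rfl | rfl
  · rw [h₁, Finset.mem_singleton, Prod.mk.injEq] at hxy
    exact Or.inl ⟨rfl, hxy.1, hxy.2⟩
  · rw [h₂, Finset.mem_singleton, Prod.mk.injEq] at hxy
    exact Or.inr (Or.inl ⟨rfl, hxy.1, hxy.2⟩)
  · rw [h₃, Finset.mem_singleton, Prod.mk.injEq] at hxy
    exact Or.inr (Or.inr (Or.inl ⟨rfl, hxy.1, hxy.2⟩))
  · rw [h₄, Finset.mem_singleton, Prod.mk.injEq] at hxy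
    exact Or.inr (Or.inr (Or.inr (Or.inl ⟨rfl, hxy.1, hxy.2⟩)))
  · rw [h₅, Finset.mem_singleton, Prod.mk.injEq] at hxy
    exact Or.inr (Or.inr (Or.inr (Or.inr ⟨rfl, hxy.1, hxy.2⟩)))

/-- The pendant set is closed out into `{t}`. -/
lemma pathStar_closedOut : ClosedOut arcs {w, v₁, v₂, v₃} {t} := by
  intro e xy hxy hx
  simp only [Finset.mem_insert, Finset.mem_singleton] at hx
  rcases pathStar_arc h₁ h₂ h₃ h₄ h₅ honly hxy hx with ⟨_, _, hy⟩ | ⟨_, _, hy⟩ | ⟨_, _, hy⟩ |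
    ⟨_, _, hy⟩ | ⟨_, _, hy⟩ <;> simp [hy]

/-- The pathstar coins carry only arcs with tails in the pendant set. -/
lemma pathStar_tailCoinsIn : TailCoinsIn arcs {w, v₁, v₂, v₃} {t} := by
  intro e he xy hxy
  obtain ⟨x'y', hx'y', hx'⟩ := he
  simp only [Finset.mem_insert, Finset.mem_singleton] at hx'
  rcases pathStar_arc h₁ h₂ h₃ h₄ h₅ honly hx'y' hx' with ⟨rfl, _, _⟩ | ⟨rfl, _, _⟩ | ⟨rfl, _, _⟩ |
    ⟨rfl, _, _⟩ | ⟨rfl, _, _⟩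
  · rw [h₁, Finset.mem_singleton] at hxy; subst hxy; simp
  · rw [h₂, Finset.mem_singleton] at hxy; subst hxy; simp
  · rw [h₃, Finset.mem_singleton] at hxy; subst hxy; simp
  · rw [h₄, Finset.mem_singleton] at hxy; subst hxy; simp
  · rw [h₅, Finset.mem_singleton] at hxy; subst hxy; simp

omit h₁ h₃ h₄ h₅ honly in
/-- `e₂` is a pendant coin. -/
lemma pathStar_e₂_mem : e₂ ∈ tailCoins arcs {w, v₁, v₂, v₃} :=
  ⟨(v₁, v₂), by rw [h₂]; exact Finset.mem_singleton_self _, by simp⟩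

omit h₁ h₂ h₄ h₅ honly in
/-- `e₃` is a pendant coin. -/
lemma pathStar_e₃_mem : e₃ ∈ tailCoins arcs {w, v₁, v₂, v₃} :=
  ⟨(v₂, t), by rw [h₃]; exact Finset.mem_singleton_self _, by simp⟩

omit h₁ h₂ h₃ h₄ honly in
/-- `e₅` is a pendant coin. -/
lemma pathStar_e₅_mem : e₅ ∈ tailCoins arcs {w, v₁, v₂, v₃} :=
  ⟨(v₃, t), by rw [h₅]; exact Finset.mem_singleton_self _, by simp⟩

omit [DecidableEq V] in
/-- The leaf `v₂` reaches `t` iff `e₃` is open. -/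
lemma pathStar_leaf₂ (hwv₂ : w ≠ v₂) (hv₁₂ : v₁ ≠ v₂) (hv₂₃ : v₂ ≠ v₃) (hv₂t : v₂ ≠ t) :
    bwdEvent arcs v₂ {t} = openEdge e₃ := by
  ext ω
  simp only [bwdEvent, Set.mem_setOf_eq, Finset.mem_singleton, exists_eq_left, openEdge]
  constructor
  · intro h
    rcases Relation.ReflTransGen.cases_head h with heq | ⟨y, ⟨e, he, hxy⟩, _⟩
    · exact absurd heq hv₂t
    · rcases pathStar_arc h₁ h₂ h₃ h₄ h₅ honly hxy (Or.inr (Or.inr (Or.inl rfl))) with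
        ⟨_, hx, _⟩ | ⟨_, hx, _⟩ | ⟨rfl, _, _⟩ | ⟨_, hx, _⟩ | ⟨_, hx, _⟩
      · exact absurd hx.symm hwv₂
      · exact absurd hx.symm hv₁₂
      · exact he
      · exact absurd hx.symm hwv₂
      · exact absurd hx hv₂₃
  · intro h
    exact reach_of_openArc ⟨e₃, h, by rw [h₃]; exact Finset.mem_singleton_self _⟩

omit [DecidableEq V] in
/-- The leaf `v₃` reaches `t` iff `e₅` is open. -/
lemma pathStar_leaf₃ (hwv₃ : w ≠ v₃) (hv₁₃ : v₁ ≠ v₃) (hv₂₃ : v₂ ≠ v₃) (hv₃t : v₃ ≠ t) :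
    bwdEvent arcs v₃ {t} = openEdge e₅ := by
  ext ω
  simp only [bwdEvent, Set.mem_setOf_eq, Finset.mem_singleton, exists_eq_left, openEdge]
  constructor
  · intro h
    rcases Relation.ReflTransGen.cases_head h with heq | ⟨y, ⟨e, he, hxy⟩, _⟩
    · exact absurd heq hv₃t
    · rcases pathStar_arc h₁ h₂ h₃ h₄ h₅ honly hxy (Or.inr (Or.inr (Or.inr rfl))) with
        ⟨_, hx, _⟩ | ⟨_, hx, _⟩ | ⟨_, hx, _⟩ | ⟨_, hx, _⟩ | ⟨rfl, _, _⟩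
      · exact absurd hx.symm hwv₃
      · exact absurd hx.symm hv₁₃
      · exact absurd hx.symm hv₂₃
      · exact absurd hx.symm hwv₃
      · exact he
  · intro h
    exact reach_of_openArc ⟨e₅, h, by rw [h₅]; exact Finset.mem_singleton_self _⟩

omit [DecidableEq V] in
/-- The inner vertex `v₁` reaches `t` iff `e₂` and `e₃` are open. -/
lemma pathStar_leaf₁ (hwv₁ : w ≠ v₁) (hwv₂ : w ≠ v₂) (hv₁₂ : v₁ ≠ v₂) (hv₁₃ : v₁ ≠ v₃)
    (hv₂₃ : v₂ ≠ v₃) (hv₁t : v₁ ≠ t) (hv₂t : v₂ ≠ t) :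
    bwdEvent arcs v₁ {t} = openEdge e₂ ∩ openEdge e₃ := by
  ext ω
  simp only [bwdEvent, Set.mem_setOf_eq, Finset.mem_singleton, exists_eq_left, openEdge,
    Set.mem_inter_iff]
  constructor
  · intro h
    rcases Relation.ReflTransGen.cases_head h with heq | ⟨y, ⟨e, he, hxy⟩, hyt⟩
    · exact absurd heq hv₁t
    · rcases pathStar_arc h₁ h₂ h₃ h₄ h₅ honly hxy (Or.inr (Or.inl rfl)) with
        ⟨_, hx, _⟩ | ⟨rfl, _, hy⟩ | ⟨_, hx, _⟩ | ⟨_, hx, _⟩ | ⟨_, hx, _⟩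
      · exact absurd hx.symm hwv₁
      · refine ⟨he, ?_⟩
        have h2 : ω ∈ bwdEvent arcs v₂ {t} := by
          simp only [bwdEvent, Set.mem_setOf_eq, Finset.mem_singleton, exists_eq_left]
          rw [hy] at hyt
          exact hyt
        rw [pathStar_leaf₂ h₁ h₂ h₃ h₄ h₅ honly hwv₂ hv₁₂ hv₂₃ hv₂t] at h2
        exact h2
      · exact absurd hx hv₁₂
      · exact absurd hx.symm hwv₁
      · exact absurd hx hv₁₃
  · rintro ⟨h2, h3⟩
    exact Relation.ReflTransGen.head ⟨e₂, h2, by rw [h₂]; exact Finset.mem_singleton_self _⟩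
      (reach_of_openArc ⟨e₃, h3, by rw [h₃]; exact Finset.mem_singleton_self _⟩)

omit [DecidableEq V] in
/-- `v₁ ∈ K⁻` forces `v₂ ∈ K⁻`. -/
lemma pathStar_imp (hwv₁ : w ≠ v₁) (hwv₂ : w ≠ v₂) (hv₁₂ : v₁ ≠ v₂) (hv₁₃ : v₁ ≠ v₃)
    (hv₂₃ : v₂ ≠ v₃) (hv₁t : v₁ ≠ t) (hv₂t : v₂ ≠ t) (ω : Config E)
    (h : ω ∈ bwdEvent arcs v₁ {t}) : ω ∈ bwdEvent arcs v₂ {t} := by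
  rw [pathStar_leaf₁ h₁ h₂ h₃ h₄ h₅ honly hwv₁ hwv₂ hv₁₂ hv₁₃ hv₂₃ hv₁t hv₂t] at h
  rw [pathStar_leaf₂ h₁ h₂ h₃ h₄ h₅ honly hwv₂ hv₁₂ hv₂₃ hv₂t]
  exact h.2

omit [DecidableEq V] in
/-- The head reaches `t` only through `v₁v₂` or through `v₃`. -/
lemma pathStar_head_exit (hwv₁ : w ≠ v₁) (hwv₂ : w ≠ v₂) (hwv₃ : w ≠ v₃) (hv₁₂ : v₁ ≠ v₂)
    (hv₁₃ : v₁ ≠ v₃) (hv₂₃ : v₂ ≠ v₃) (hwt : w ≠ t) (hv₁t : v₁ ≠ t) (hv₂t : v₂ ≠ t)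
    (ω : Config E) (h : ω ∈ bwdEvent arcs w {t}) :
    (ω ∈ bwdEvent arcs v₁ {t} ∧ ω ∈ bwdEvent arcs v₂ {t}) ∨ ω ∈ bwdEvent arcs v₃ {t} := by
  have h' := h
  simp only [bwdEvent, Set.mem_setOf_eq, Finset.mem_singleton, exists_eq_left] at h'
  rcases Relation.ReflTransGen.cases_head h' with heq | ⟨y, ⟨e, _, hxy⟩, hyt⟩
  · exact absurd heq hwt
  · rcases pathStar_arc h₁ h₂ h₃ h₄ h₅ honly hxy (Or.inl rfl) with ⟨_, _, hy⟩ | ⟨_, hx, _⟩ |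
      ⟨_, hx, _⟩ | ⟨_, _, hy⟩ | ⟨_, hx, _⟩
    · have h1 : ω ∈ bwdEvent arcs v₁ {t} := by
        simp only [bwdEvent, Set.mem_setOf_eq, Finset.mem_singleton, exists_eq_left]
        rw [hy] at hyt
        exact hyt
      exact Or.inl ⟨h1, pathStar_imp h₁ h₂ h₃ h₄ h₅ honly hwv₁ hwv₂ hv₁₂ hv₁₃ hv₂₃ hv₁t hv₂t ω h1⟩
    · exact absurd hx hwv₁
    · exact absurd hx hwv₂
    · right
      simp only [bwdEvent, Set.mem_setOf_eq, Finset.mem_singleton, exists_eq_left]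
      rw [hy] at hyt
      exact hyt
    · exact absurd hx hwv₃

end PathStarCoins

section Theorem

open Classical

variable {V : Type*} {E : Type*} [Fintype V] [DecidableEq V] [Fintype E] [DecidableEq E]
  {R : Type*} [Field R] [LinearOrder R] [IsStrictOrderedRing R]

/-- **THEOREM (the literal pathstar, row 2′DARC, ALL regimes).** Coins `e₁ = {w → v₁}`,
`e₂ = {v₁ → v₂}`, `e₃ = {v₂ → t}`, `e₄ = {w → v₃}`, `e₅ = {v₃ → t}` are the only coins with tails in
`{w, v₁, v₂, v₃}`; any probabilities; entries into the pendant set and the rest of the system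
arbitrary (`SameEnds`); `t ∉ {w, v₁, v₂, v₃}`; `a, b, u ∉ {w, v₁, v₂, v₃, t}`; the reduced
avoidance events of positive probability.  Then `Φ_D({s ↛ t in D + (u → w)}) ≥ 0`. -/
theorem darc_of_pathStar_coins (p : E → R) (hp : IsProbVec p) {arcs : E → Finset (V × V)}
    (hS : SameEnds arcs) (s a b u w v₁ v₂ v₃ t : V) (hwv₁ : w ≠ v₁) (hwv₂ : w ≠ v₂)
    (hwv₃ : w ≠ v₃) (hv₁₂ : v₁ ≠ v₂) (hv₁₃ : v₁ ≠ v₃) (hv₂₃ : v₂ ≠ v₃) (hwt : w ≠ t)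
    (hv₁t : v₁ ≠ t) (hv₂t : v₂ ≠ t) (hv₃t : v₃ ≠ t) {e₁ e₂ e₃ e₄ e₅ : E} (hne₂₃ : e₂ ≠ e₃)
    (h₁ : arcs e₁ = {(w, v₁)}) (h₂ : arcs e₂ = {(v₁, v₂)}) (h₃ : arcs e₃ = {(v₂, t)})
    (h₄ : arcs e₄ = {(w, v₃)}) (h₅ : arcs e₅ = {(v₃, t)})
    (honly : OnlyPathStarCoins arcs w v₁ v₂ v₃ e₁ e₂ e₃ e₄ e₅)
    (ha : a ∉ ({w, v₁, v₂, v₃} : Finset V) ∪ {t}) (hb : b ∉ ({w, v₁, v₂, v₃} : Finset V) ∪ {t})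
    (hu : u ∉ ({w, v₁, v₂, v₃} : Finset V) ∪ {t})
    (hP : ∀ Z ∈ ({w, v₁, v₂, v₃} : Finset V).powerset,
      0 < prob p (avoidEvent (arcsOff arcs ({w, v₁, v₂, v₃} ∪ {t})) s (Z ∪ {t})))
    (hQ : ∀ Z ∈ ({w, v₁, v₂, v₃} : Finset V).powerset,
      0 < prob p (avoidEvent (arcsOff arcs ({w, v₁, v₂, v₃} ∪ {t})) s (gateTarget u w Z {t}))) :
    DARC p arcs s {t} a b u w :=
  darc_of_pathStar_mixed p hp hS s a b u w v₁ v₂ v₃ t hwv₁ hwv₂ hwv₃ hv₁₂ hv₁₃ hv₂₃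
    (pathStar_closedOut h₁ h₂ h₃ h₄ h₅ honly) (pathStar_tailCoinsIn h₁ h₂ h₃ h₄ h₅ honly) hne₂₃
    (pathStar_e₂_mem h₂) (pathStar_e₃_mem h₃) (pathStar_e₅_mem h₅)
    (pathStar_leaf₁ h₁ h₂ h₃ h₄ h₅ honly hwv₁ hwv₂ hv₁₂ hv₁₃ hv₂₃ hv₁t hv₂t)
    (pathStar_leaf₂ h₁ h₂ h₃ h₄ h₅ honly hwv₂ hv₁₂ hv₂₃ hv₂t)
    (pathStar_leaf₃ h₁ h₂ h₃ h₄ h₅ honly hwv₃ hv₁₃ hv₂₃ hv₃t)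
    (pathStar_imp h₁ h₂ h₃ h₄ h₅ honly hwv₁ hwv₂ hv₁₂ hv₁₃ hv₂₃ hv₁t hv₂t)
    (pathStar_head_exit h₁ h₂ h₃ h₄ h₅ honly hwv₁ hwv₂ hwv₃ hv₁₂ hv₁₃ hv₂₃ hwt hv₁t hv₂t)
    ha hb hu hP hQ

end Theorem

end Summit.Ventures.PercRepro2.Coin
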